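import Summits.AtomisticToContinuum.Crystallization.Theorems.ThreeConeCertificateSlackRigidityLawCellAverage
import Summits.AtomisticToContinuum.Crystallization.Theorems.SlackRigidity.Negative.WitnessBasics
import Literature.Probability.Process.LocallyMatches
import HarnessLib

/-!
# Law rigidity, bad side: the cell average of the deep-bad-root indicator is at most the bad fraction of the cluster

Support file for the crux `ThreeConeCertificate.SlackRigidity` (stmt-AtomisticToContinuum-11960), line
`ekeland-surgery-parity`, lead c14's law-rigidity programme.  The cell-averaging identity is applied to
the BAD functional `f_B(μ, v) = 1[μ ∉ G] · 1[v deep]`, where `G` is any measurable version of the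
event "the root is `(R, ε)`-good" (`∃ A, LocallyMatches R ε (atoms μ) (A '' P₀.points)`; existence of
such a version is the registered stub `exists_measurableSet_good`) and the DEEP phases are those for
which the closed `R`-ball about the root lies inside the root's cell,
`{v | ∀ i, ⌊-v i⌋ ≤ -R/L - v i ∧ R/L - v i < ⌊-v i⌋ + 1}` (measurable, `ℤ³`-periodic,
`closedBall_subset_rootCell_of_deep`, and of asymptotically full volume, `tendsto_volume_deep`).

* `lintegral_badFunctional_eq` — OUT: `E_P[∫ f_B dv] = P(Gᶜ) · vol(deep phases)`;
* `cellAvg_bad_le` — IN, pointwise: at a rooted hard-core `count|S`, phase `v`, cluster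
  `T = rootCell L v ∩ S`, the cell average of `f_B` is at most
  `#{y ∈ T | y is (R, ε)-bad WITHIN THE FINITE CLUSTER T} / #T`: a cell-mate `y` whose `R`-ball lies
  inside the cell and which is bad in the infinite configuration `S` is bad in `T`
  (`not_good_cluster_of_not_good`).
All `[folklore]`.
-/

noncomputable section

open MeasureTheory Filter Set
open scoped ENNReal BigOperators Topology

namespace Summit.AtomisticToContinuum.Crystallization.Theorems.SlackRigidityLawBad

open Literature.Probability.Process
open Literature.MathematicalPhysics.StatisticalMechanics (PeriodicConfiguration)
open Summit.AtomisticToContinuum.Crystallization.Theorems.PalmUnimodularRigidityMinimiserShells.EnergyFloor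
open Summit.AtomisticToContinuum.Crystallization.Theorems.MinimiserShells.Negative.Rootedness
  (countable_of_separated)
open Summit.AtomisticToContinuum.Crystallization.Theorems.SlackRigidityNegative (E3)

variable {L R : ℝ}

/-! ## Deep phases -/

/-- **Deep phases are measurable.** [folklore] -/
theorem measurableSet_deep (L R : ℝ) :
    MeasurableSet {v : E3 | ∀ i, ((⌊-v i⌋ : ℤ) : ℝ) ≤ -R / L - v i ∧ R / L - v i < ⌊-v i⌋ + 1} := by
  have h : {v : E3 | ∀ i, ((⌊-v i⌋ : ℤ) : ℝ) ≤ -R / L - v i ∧ R / L - v i < ⌊-v i⌋ + 1} =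
      ⋂ i, ({v : E3 | ((⌊-v i⌋ : ℤ) : ℝ) ≤ -R / L - v i} ∩ {v : E3 | R / L - v i < ⌊-v i⌋ + 1}) := by
    ext v; simp
  rw [h]
  have hfl : ∀ i, Measurable fun v : E3 => ((⌊-v i⌋ : ℤ) : ℝ) := fun i =>
    (measurable_from_top (f := fun m : ℤ => (m : ℝ))).comp
      (Int.measurable_floor.comp (measurable_coord i).neg)
  refine MeasurableSet.iInter fun i => (measurableSet_le (hfl i) ?_).inter (measurableSet_lt ?_ ?_)
  · exact measurable_const.sub (measurable_coord i)
  · exact measurable_const.sub (measurable_coord i)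
  · exact (hfl i).add_const _

/-- **Deep phases are `ℤ³`-periodic.** [folklore] -/
theorem deep_int_add_iff {k : E3} (hk : ∀ i, ∃ m : ℤ, k i = m) (v : E3) :
    (k + v) ∈ {v : E3 | ∀ i, ((⌊-v i⌋ : ℤ) : ℝ) ≤ -R / L - v i ∧ R / L - v i < ⌊-v i⌋ + 1} ↔
      v ∈ {v : E3 | ∀ i, ((⌊-v i⌋ : ℤ) : ℝ) ≤ -R / L - v i ∧ R / L - v i < ⌊-v i⌋ + 1} := by
  simp only [Set.mem_setOf_eq]
  refine forall_congr' fun i => ?_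
  rw [show (k + v) i = k i + v i from rfl]
  obtain ⟨m, hm⟩ := hk i
  rw [hm, show -((m : ℝ) + v i) = -v i + ((-m : ℤ) : ℝ) by push_cast; ring, Int.floor_add_intCast]
  push_cast
  constructor <;> rintro ⟨h1, h2⟩ <;> constructor <;> linarith

/-- **On a deep phase the closed `R`-ball about the root lies in the root's cell** (`L > 0`).
[folklore] -/
theorem closedBall_subset_rootCell_of_deep (hL : 0 < L) {v : E3}
    (hv : v ∈ {v : E3 | ∀ i, ((⌊-v i⌋ : ℤ) : ℝ) ≤ -R / L - v i ∧ R / L - v i < ⌊-v i⌋ + 1}) :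
    Metric.closedBall (0 : E3) R ⊆ rootCell L v := by
  intro z hz
  rw [Metric.mem_closedBall, dist_zero_right] at hz
  rw [mem_rootCell]
  funext i
  obtain ⟨h1, h2⟩ := hv i
  have hzi : |z i| ≤ R := by
    have hsum : ‖z i‖ ^ 2 ≤ ∑ j, ‖z j‖ ^ 2 :=
      Finset.single_le_sum (f := fun j => ‖z j‖ ^ 2) (fun j _ => sq_nonneg _) (Finset.mem_univ i)
    have : |z i| ≤ ‖z‖ := by
      rw [EuclideanSpace.norm_eq, ← Real.norm_eq_abs, ← Real.sqrt_sq (norm_nonneg (z i))]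
      exact Real.sqrt_le_sqrt hsum
    exact this.trans hz
  show ⌊z i / L - v i⌋ = ⌊(0 : E3) i / L - v i⌋
  rw [PiLp.zero_apply, zero_div, zero_sub, Int.floor_eq_iff]
  rw [abs_le] at hzi
  have hlo : -R / L ≤ z i / L := div_le_div_of_nonneg_right hzi.1 hL.le
  have hhi : z i / L ≤ R / L := div_le_div_of_nonneg_right hzi.2 hL.le
  constructor <;> linarith

/-- **Deep phases have asymptotically full volume**: `vol([0,1)³ ∩ deep) → vol([0,1)³)` as
`L = n + 1 → ∞` (every phase of the open cube is eventually deep; dominated convergence).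
[folklore] -/
theorem tendsto_volume_deep (R : ℝ) :
    Tendsto (fun n : ℕ => volume (phaseDom ∩ {v : E3 | ∀ i, ((⌊-v i⌋ : ℤ) : ℝ) ≤ -R / ((n : ℝ) + 1) - v i ∧
      R / ((n : ℝ) + 1) - v i < ⌊-v i⌋ + 1})) atTop (𝓝 (volume phaseDom)) := by
  set D : ℕ → Set E3 := fun n => {v : E3 | ∀ i, ((⌊-v i⌋ : ℤ) : ℝ) ≤ -R / ((n : ℝ) + 1) - v i ∧
      R / ((n : ℝ) + 1) - v i < ⌊-v i⌋ + 1} with hD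
  have hDm : ∀ n, MeasurableSet (D n) := fun n => measurableSet_deep _ R
  have hFn : ∀ n, volume (phaseDom ∩ D n) =
      ∫⁻ v in phaseDom, (D n).indicator 1 v ∂(volume : Measure E3) := fun n => by
    rw [lintegral_indicator_one (hDm n), Measure.restrict_apply (hDm n), Set.inter_comm]
  change Tendsto (fun n : ℕ => volume (phaseDom ∩ D n)) atTop (𝓝 (volume phaseDom))
  simp_rw [hFn]
  have hlim : ∫⁻ _v in phaseDom, (1 : ℝ≥0∞) ∂(volume : Measure E3) = volume phaseDom := by
    rw [setLIntegral_const, one_mul]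
  rw [← hlim]
  refine tendsto_lintegral_of_dominated_convergence (fun _ => 1) (fun n => measurable_one.indicator (hDm n))
    (fun n => Eventually.of_forall fun v => Set.indicator_le_self _ _ v) ?_ ?_
  · rw [setLIntegral_const, one_mul]
    exact volume_phaseDom_ne_top
  · filter_upwards [ae_restrict_phaseDom_pos] with v hv
    have hev : ∀ᶠ n : ℕ in atTop, v ∈ D n := by
      have h1 : ∀ i, ∀ᶠ n : ℕ in atTop, ((⌊-v i⌋ : ℤ) : ℝ) ≤ -R / ((n : ℝ) + 1) - v i ∧
          R / ((n : ℝ) + 1) - v i < ⌊-v i⌋ + 1 := by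
        intro i
        obtain ⟨h0, h1⟩ := hv i
        have hfl : ⌊-v i⌋ = -1 := by
          rw [Int.floor_eq_iff]; push_cast; constructor <;> linarith
        have ht : Tendsto (fun n : ℕ => R / ((n : ℝ) + 1)) atTop (𝓝 0) :=
          tendsto_const_nhds.div_atTop (tendsto_atTop_add_const_right _ _ tendsto_natCast_atTop_atTop)
        have hε : 0 < min (v i) (1 - v i) := lt_min h0 (by linarith)
        filter_upwards [ht.eventually (Metric.ball_mem_nhds (0 : ℝ) hε)] with n hn
        rw [Real.dist_eq, sub_zero, abs_lt, lt_min_iff, neg_lt, lt_min_iff] at hn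
        obtain ⟨⟨ha, hb⟩, hc, hd⟩ := hn
        rw [hfl]; push_cast
        rw [neg_div]
        constructor <;> linarith
      exact (eventually_all.2 h1).mono fun n hn => hn
    refine tendsto_const_nhds.congr' (hev.mono fun n hn => ?_)
    exact (Set.indicator_of_mem hn (1 : E3 → ℝ≥0∞)).symm

/-! ## The bad functional `f_B(μ, v) = 1[μ ∉ G] · 1[v deep]` -/

variable {G : Set (Measure E3)}

/-- The bad functional is jointly measurable. [folklore] -/
theorem measurable_badFunctional (hG : MeasurableSet G) (L R : ℝ) :
    Measurable (Function.uncurry fun (μ : Measure E3) (v : E3) =>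
      Gᶜ.indicator (1 : Measure E3 → ℝ≥0∞) μ *
        {v : E3 | ∀ i, ((⌊-v i⌋ : ℤ) : ℝ) ≤ -R / L - v i ∧ R / L - v i < ⌊-v i⌋ + 1}.indicator
          (1 : E3 → ℝ≥0∞) v) :=
  ((measurable_one.indicator hG.compl).comp measurable_fst).mul
    ((measurable_one.indicator (measurableSet_deep L R)).comp measurable_snd)

/-- The bad functional is `ℤ³`-periodic in the phase. [folklore] -/
theorem badFunctional_periodic (G : Set (Measure E3)) (L R : ℝ) :
    ∀ (μ : Measure E3) (k v : E3), (∀ i, ∃ m : ℤ, k i = m) →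
      Gᶜ.indicator (1 : Measure E3 → ℝ≥0∞) μ *
        {v : E3 | ∀ i, ((⌊-v i⌋ : ℤ) : ℝ) ≤ -R / L - v i ∧ R / L - v i < ⌊-v i⌋ + 1}.indicator
          (1 : E3 → ℝ≥0∞) (k + v) =
      Gᶜ.indicator (1 : Measure E3 → ℝ≥0∞) μ *
        {v : E3 | ∀ i, ((⌊-v i⌋ : ℤ) : ℝ) ≤ -R / L - v i ∧ R / L - v i < ⌊-v i⌋ + 1}.indicator
          (1 : E3 → ℝ≥0∞) v := by
  intro μ k v hk
  by_cases hv : v ∈ {v : E3 | ∀ i, ((⌊-v i⌋ : ℤ) : ℝ) ≤ -R / L - v i ∧ R / L - v i < ⌊-v i⌋ + 1}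
  · rw [Set.indicator_of_mem hv, Set.indicator_of_mem ((deep_int_add_iff hk v).2 hv)]
    rfl
  · rw [Set.indicator_of_notMem hv,
      Set.indicator_of_notMem (fun h => hv ((deep_int_add_iff hk v).1 h))]

/-- **OUT for the bad functional**: `E_P[∫_{[0,1)³} f_B dv] = P(Gᶜ) · vol([0,1)³ ∩ deep)`.
[folklore] -/
theorem lintegral_badFunctional_eq (hG : MeasurableSet G) (L R : ℝ) (P : Measure (Measure E3)) :
    ∫⁻ μ, (∫⁻ v in phaseDom, Gᶜ.indicator (1 : Measure E3 → ℝ≥0∞) μ *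
        {v : E3 | ∀ i, ((⌊-v i⌋ : ℤ) : ℝ) ≤ -R / L - v i ∧ R / L - v i < ⌊-v i⌋ + 1}.indicator
          (1 : E3 → ℝ≥0∞) v) ∂P =
      P Gᶜ * volume (phaseDom ∩ {v : E3 | ∀ i, ((⌊-v i⌋ : ℤ) : ℝ) ≤ -R / L - v i ∧
        R / L - v i < ⌊-v i⌋ + 1}) := by
  have hD := measurableSet_deep L R
  have hinner : ∀ μ : Measure E3, (∫⁻ v in phaseDom, Gᶜ.indicator (1 : Measure E3 → ℝ≥0∞) μ *
      {v : E3 | ∀ i, ((⌊-v i⌋ : ℤ) : ℝ) ≤ -R / L - v i ∧ R / L - v i < ⌊-v i⌋ + 1}.indicator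
        (1 : E3 → ℝ≥0∞) v) =
      Gᶜ.indicator (1 : Measure E3 → ℝ≥0∞) μ * volume (phaseDom ∩ {v : E3 | ∀ i,
        ((⌊-v i⌋ : ℤ) : ℝ) ≤ -R / L - v i ∧ R / L - v i < ⌊-v i⌋ + 1}) := by
    intro μ
    rw [lintegral_const_mul _ (measurable_one.indicator hD), lintegral_indicator_one hD,
      Measure.restrict_apply hD, Set.inter_comm]
  simp_rw [hinner]
  rw [lintegral_mul_const _ (measurable_one.indicator hG.compl), lintegral_indicator_one hG.compl]

/-! ## IN for the bad functional: deep cell-mates that are bad in `S` are bad in the cluster -/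

variable {P₀ : PeriodicConfiguration 3} {ε δ : ℝ} {S : Set E3}

/-- **A deep cell-mate that is bad in the infinite configuration is bad in the finite cluster.**
If `closedBall y R ⊆ rootCell L v` and `T = rootCell L v ∩ S`, a two-way `(R, ε)`-matching of
`T - y` with a pattern is a matching of `S - y` with it. [folklore] -/
theorem not_good_cluster_of_not_good {T : Finset E3} {v y : E3}
    (hT : (↑T : Set E3) = rootCell L v ∩ S) (hyR : Metric.closedBall y R ⊆ rootCell L v)
    (hbad : ¬ ∃ A : E3 →ₗᵢ[ℝ] E3, LocallyMatches R ε ((fun z : E3 => z - y) '' S) (A '' P₀.points)) :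
    ¬ ∃ A : E3 →ₗᵢ[ℝ] E3, LocallyMatches R ε ((fun z : E3 => z - y) '' (↑T : Set E3)) (A '' P₀.points) := by
  rintro ⟨A, h1, h2⟩
  refine hbad ⟨A, fun p hp hpR => ?_, fun q hq hqR => ?_⟩
  · obtain ⟨q, ⟨z, hz, rfl⟩, hd⟩ := h1 p hp hpR
    have hzS : z ∈ S := by
      have : z ∈ rootCell L v ∩ S := by rw [← hT]; exact hz
      exact this.2
    exact ⟨z - y, ⟨z, hzS, rfl⟩, hd⟩
  · obtain ⟨z, hz, rfl⟩ := hq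
    have hzT : z ∈ (↑T : Set E3) := by
      rw [hT]
      refine ⟨hyR ?_, hz⟩
      rw [Metric.mem_closedBall, dist_eq_norm]
      exact hqR
    exact h2 (z - y) ⟨z, hzT, rfl⟩ hqR

/-- Counting the points of a finset with a property: the cardinality of the subtype is the
cardinality of the filter. [folklore] -/
theorem natCard_subtype_eq_card_filter (T : Finset E3) (p : E3 → Prop) [DecidablePred p] :
    Nat.card {y : T // p (y : E3)} = (T.filter p).card := by
  rw [Nat.card_eq_fintype_card, Fintype.card_subtype, Finset.card_filter, Finset.card_filter,
    Finset.univ_eq_attach, Finset.sum_attach T (fun y => if p y then 1 else 0)]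

/-- Counting the bad points of a cluster: the `0/1`-sum over the finset is the cardinality of the
subtype. [folklore] -/
theorem sum_boole_eq_natCard (T : Finset E3) (p : E3 → Prop) [DecidablePred p] :
    (∑ y ∈ T, (if p y then (1 : ℝ≥0∞) else 0)) = (Nat.card {y : T // p (y : E3)} : ℝ≥0∞) := by
  rw [Finset.sum_boole, natCard_subtype_eq_card_filter]

/-- **IN bound for the bad functional, pointwise.** At a rooted `δ`-hard-core configuration
`count|S`, a phase `v` with cluster `T = rootCell L v ∩ S`, and a measurable version `G` of the
good-root event on rooted `δ`-hard-core configurations, the cell average of `f_B` is at most the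
fraction of points of `T` that are `(R, ε)`-bad within `T`. [folklore] -/
theorem cellAvg_bad_le (hL : 0 < L) (h0 : (0 : E3) ∈ S)
    (hsep : ∀ x ∈ S, ∀ y ∈ S, x ≠ y → δ ≤ dist x y)
    (hG : ∀ μ : Measure E3, IsRootedHardCore δ μ →
      (μ ∈ G ↔ ∃ A : E3 →ₗᵢ[ℝ] E3, LocallyMatches R ε (atoms μ) (A '' P₀.points)))
    {T : Finset E3} {v : E3} (hT : (↑T : Set E3) = rootCell L v ∩ S) :
    (∫⁻ y in rootCell L v, Gᶜ.indicator (1 : Measure E3 → ℝ≥0∞)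
        (((Measure.count : Measure E3).restrict S).map fun z => z - y) *
        {v : E3 | ∀ i, ((⌊-v i⌋ : ℤ) : ℝ) ≤ -R / L - v i ∧ R / L - v i < ⌊-v i⌋ + 1}.indicator
          (1 : E3 → ℝ≥0∞) (v - L⁻¹ • y) ∂((Measure.count : Measure E3).restrict S)) /
      ((Measure.count : Measure E3).restrict S) (rootCell L v) ≤
    (Nat.card {y : T // ¬ ∃ A : E3 →ₗᵢ[ℝ] E3,
        LocallyMatches R ε ((fun z : E3 => z - (y : E3)) '' (T : Set E3)) (A '' P₀.points)} : ℝ≥0∞) /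
      T.card := by
  classical
  have hμ : IsRootedHardCore δ ((Measure.count : Measure E3).restrict S) := ⟨S, h0, hsep, rfl⟩
  rw [setLIntegral_rootCell_eq_sum hT, count_restrict_rootCell_eq_card hT]
  gcongr
  rw [← sum_boole_eq_natCard T (fun y => ¬ ∃ A : E3 →ₗᵢ[ℝ] E3,
    LocallyMatches R ε ((fun z : E3 => z - y) '' (T : Set E3)) (A '' P₀.points))]
  refine Finset.sum_le_sum fun y hy => ?_
  have hyS : y ∈ rootCell L v ∩ S := by rw [← hT]; exact hy
  by_cases hG' : (((Measure.count : Measure E3).restrict S).map fun z => z - y) ∈ G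
  · rw [Set.indicator_of_notMem (fun h : _ ∈ Gᶜ => h hG'), zero_mul]; exact bot_le
  by_cases hv : (v - L⁻¹ • y) ∈ {v : E3 | ∀ i, ((⌊-v i⌋ : ℤ) : ℝ) ≤ -R / L - v i ∧
      R / L - v i < ⌊-v i⌋ + 1}
  · -- both indicators are `1`: `y` is deep and bad in `S`, hence bad in `T`
    have hν : IsRootedHardCore δ (((Measure.count : Measure E3).restrict S).map fun z => z - y) :=
      hμ.map_sub ((count_restrict_singleton_ne_zero_iff S y).2 hyS.2)
    have hbadS : ¬ ∃ A : E3 →ₗᵢ[ℝ] E3,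
        LocallyMatches R ε ((fun z : E3 => z - y) '' S) (A '' P₀.points) := by
      intro h
      refine hG' ((hG _ hν).2 ?_)
      rwa [atoms_map_sub_right, atoms_count_restrict]
    have hyR : Metric.closedBall y R ⊆ rootCell L v := by
      intro z hz
      have hz' : z - y ∈ Metric.closedBall (0 : E3) R := by
        rwa [Metric.mem_closedBall, dist_zero_right, ← dist_eq_norm]
      have h := closedBall_subset_rootCell_of_deep hL hv hz'
      have h' : z ∈ (fun w => w - y) ⁻¹' rootCell L (v - L⁻¹ • y) := h
      rwa [preimage_sub_rootCell hL.ne' hyS.1] at h'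
    have hb := not_good_cluster_of_not_good (P₀ := P₀) (ε := ε) hT hyR hbadS
    rw [if_pos hb, Set.indicator_of_mem (show _ ∈ Gᶜ from hG'), Set.indicator_of_mem hv]
    simp
  · rw [Set.indicator_of_notMem hv, mul_zero]; exact bot_le

/-- **Registered form** (stub `badFunctional_out` of crux stmt-AtomisticToContinuum-11960): OUT for the
bad functional. [folklore] -/
theorem badFunctional_out : ∀ (G : Set (Measure E3)), MeasurableSet G → ∀ (L R : ℝ) (P : Measure (Measure E3)), ∫⁻ μ, (∫⁻ v in phaseDom, Gᶜ.indicator (1 : Measure E3 → ℝ≥0∞) μ * {v : E3 | ∀ i, ((⌊-v i⌋ : ℤ) : ℝ) ≤ -R / L - v i ∧ R / L - v i < ⌊-v i⌋ + 1}.indicator (1 : E3 → ℝ≥0∞) v) ∂P = P Gᶜ * volume (phaseDom ∩ {v : E3 | ∀ i, ((⌊-v i⌋ : ℤ) : ℝ) ≤ -R / L - v i ∧ R / L - v i < ⌊-v i⌋ + 1}) :=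
  fun _ hG L R P => lintegral_badFunctional_eq hG L R P

end Summit.AtomisticToContinuum.Crystallization.Theorems.SlackRigidityLawBad

end
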